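import Summits.BirchSwinnertonDyer.BirchSwinnertonDyer.Theorems.EisensteinPrimesX2AnalyticLambdaResultantCertificate
import Summits.BirchSwinnertonDyer.BirchSwinnertonDyer.Theorems.EisensteinPrimesAnalyticLambdaCongruenceTransfer
import HarnessLib

/-!
# Route `EisensteinPrimes`, line `mudescent`, cruxes 3/5: from a congruence of SPECIAL VALUES at all
# `p`-power roots of unity to the `Λ`-adic congruence mod `p` — the Weierstrass step of the relative
# analytic λ-count, and the X2 ← X2 transfer socket fed by VALUES (helper; THEOREMS ONLY)

Seat `bsd-eis-lam-a` g8 (PROGRAMME PART 1b, ACCEL-LIST (4): ANALYTIC side of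
`stub_lambdaCount_offLocus`; items stmt-BirchSwinnertonDyer-19033 / -19035; skeleton owner bsd-eis-ky,
`Lines/mudescent.lean`; research object (C-λ) = aside stmt-BirchSwinnertonDyer-20112). No definition,
no named fact, nothing about any particular curve; closes nothing; moves no label.

WHAT AND WHY (HOME/lam-a-g8/lam-a-MEMO-8.md, THEOREM A, Cor. A2 (ii) ⟹ (iii)). THEOREM A compares the
mod-`p` plus modular symbols of two type-A twins on the CLOSED cycles of `X₀(M)`; what it delivers for
the `p`-adic `L`-functions `G, G′ ∈ Λ` (ε-stabilised, Néron-normalised) is a congruence of their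
VALUES: `G(ζ − 1) ≡ c·G′(ζ − 1) (mod p)` in `ℂ_p` for every primitive `p^{n+1}`-th root of unity `ζ`
(`n ≥ n₀`), with ONE `p`-adic unit `c` — these values being the twisted special values
`τ(χ̄)L(E,χ,1)/Ω_E` at the even characters `χ ↔ ζ`. The transfer sockets of this line
(`EisensteinPrimesAnalyticLambdaCongruenceTransfer`, lam-a g5) consume instead a truncated congruence
of COEFFICIENTS, `[T^j](G·P) = u·[T^j](G′·P′)` in `𝔽_p` for `j < K`. This file is the bridge:

* §1 `C_p_dvd_of_forall_norm_tsum_le` — THE WEIERSTRASS STEP: if `H ∈ Λ` satisfies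
  `‖H(ζ − 1)‖ ≤ 1/p` for all primitive `p^{n+1}`-th roots `ζ`, all `n ≥ n₀`, then `p ∣ H` in `Λ`
  (because `‖H(ζ − 1)‖ = p^{−μ(H)}‖ζ − 1‖^{λ(H)}` and `‖ζ − 1‖^{λ} > 1/p` as soon as `φ(p^{n+1}) > λ`:
  tree `Iwasawa.one_le_mu_or_pow_lam_le_of_norm_tsum_le`, `Iwasawa.inv_lt_norm_sub_one_pow_iff`);
  `coeff_toZMod_eq_of_C_p_dvd_sub` and `forall_coeff_toZMod_eq_of_forall_norm_tsum_le` — hence the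
  coefficient congruence `[T^j]G₁ = c̄·[T^j]G₂` in `𝔽_p` for EVERY `j`.
* §2 `X2.analyticMuLE_zero_and_analyticLambdaEq_of_valueCongr` — the g5 socket
  `X2.analyticMuLE_zero_and_analyticLambdaEq_of_truncCongr` with its displayed `(u, K, hcong, hK)`
  replaced by `(c, n₀, hval)`: a unit `c ∈ ℤ_p` and the value congruence of `G·P − C(c)·G′·P′` at all
  primitive roots of unity of level `> n₀` ⟹ `X2.AnalyticMuLE W p 0 ∧ X2.AnalyticLambdaEq W p n`.

HONEST FRAMING. The value congruence `hval` is what MEMO-8 THEOREM A / Cor. A2 PROVE (on paper, from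
Vatsal 2005 Thm. 1.1 + Ohta 2014 Thm. (3.6.2)) for case-(ii) twins at a common squarefree level; it is
NOT asserted here — the tree has no `J₀(N)` vocabulary, so this file displays the hypothesis in the
currency the theorem produces (values at `ζ − 1`, one unit) and proves everything downstream of it.

References: [Washington1997] §7.1–7.2 (Thm. 7.3); [GreenbergVatsal2000] §1 (9)–(10), Thm. (1.4);
[Vatsal2005] Thm. 1.1; [Ohta2014] Thm. (3.6.2); HOME/lam-a-g8/lam-a-MEMO-8.md §4 Cor. A2.
-/

set_option linter.dupNamespace false
set_option autoImplicit false

noncomputable section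

open scoped Classical MatrixGroups ModularForm

open PowerSeries CongruenceSubgroup WeierstrassCurve
  Literature.NumberTheory.EllipticCurves
  Literature.NumberTheory.EllipticCurves.ModularForms
  Literature.NumberTheory.EllipticCurves.GreenbergVatsal2000
  Summit.BirchSwinnertonDyer.Rank1Residual
  Summit.BirchSwinnertonDyer.Rank1Residual.X1.MuLambda
  Summit.BirchSwinnertonDyer.Rank1Residual.Iwasawa
  Summit.BirchSwinnertonDyer.BirchSwinnertonDyer.Theorems
  Summit.BirchSwinnertonDyer.BirchSwinnertonDyer.Theorems.EisensteinPrimesAnalyticLambdaCongruenceTransfer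
  Summit.BirchSwinnertonDyer.BirchSwinnertonDyer.Theorems.EisensteinPrimesX2AnalyticLambdaResultantCertificate

namespace Summit.BirchSwinnertonDyer.BirchSwinnertonDyer.Theorems.EisensteinPrimesAnalyticLambdaValueCongruence

variable {p : ℕ} [hp : Fact p.Prime]

/-! ## §1. The Weierstrass step: small values at all `ζ − 1` force divisibility by `p` -/

section Algebra

/-- `λ(H) < φ(p^{n+1})` as soon as `n ≥ λ(H)` (`φ(p^{n+1}) = pⁿ(p − 1) ≥ pⁿ > n`). [folklore] -/
theorem lam_lt_totient_of_le {H : IwasawaAlgebra p} {n : ℕ} (hn : lam H ≤ n) :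
    lam H < Nat.totient (p ^ (n + 1)) := by
  have hp1 : 1 < p := hp.out.one_lt
  rw [Nat.totient_prime_pow_succ hp.out]
  have h1 : n < p ^ n := Nat.lt_pow_self hp1
  have h2 : p ^ n ≤ p ^ n * (p - 1) := Nat.le_mul_of_pos_right _ (by omega)
  omega

/-- **THE WEIERSTRASS STEP.** If `H ∈ Λ = ℤ_p⟦T⟧` has `‖H(ζ − 1)‖_p ≤ 1/p` for every primitive
`p^{n+1}`-th root of unity `ζ ∈ ℂ_p` and every `n ≥ n₀`, then `p ∣ H` in `Λ`. (Write
`H = p^μ·P·U`; for `φ(p^{n+1}) > λ(H) = deg P` one has `‖H(ζ − 1)‖ = p^{−μ}‖ζ − 1‖^{λ} > p^{−μ−1}`,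
so `μ ≥ 1`.) [cite: Washington1997, §7.1–7.2, Thm. 7.3] -/
theorem C_p_dvd_of_forall_norm_tsum_le {H : IwasawaAlgebra p} {n₀ : ℕ}
    (h : ∀ n : ℕ, n₀ ≤ n → ∀ ζ : ℂ_[p], IsPrimitiveRoot ζ (p ^ (n + 1)) →
      ‖∑' k, ((algebraMap ℚ_[p] ℂ_[p]).comp (algebraMap ℤ_[p] ℚ_[p])) (PowerSeries.coeff k H) *
        (ζ - 1) ^ k‖ ≤ (p : ℝ)⁻¹) :
    PowerSeries.C (p : ℤ_[p]) ∣ H := by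
  by_cases hH0 : H = 0
  · rw [hH0]; exact dvd_zero _
  set n : ℕ := max n₀ (lam H) with hn
  obtain ⟨ζ, hζ⟩ := exists_isPrimitiveRoot_padicComplex (p := p) n
  have hz : ‖ζ - 1‖ < 1 := (norm_sub_one_pos_and_lt_one hζ).2
  rcases one_le_mu_or_pow_lam_le_of_norm_tsum_le hH0 hz (h n (le_max_left _ _) ζ hζ) with hμ | hle
  · obtain ⟨Q, hQ⟩ := C_pow_mu_dvd hH0
    refine ⟨PowerSeries.C ((p : ℤ_[p]) ^ (mu H - 1)) * Q, ?_⟩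
    rw [← mul_assoc, ← map_mul, ← pow_succ', Nat.sub_add_cancel hμ]
    exact hQ
  · exfalso
    have hlt : lam H < Nat.totient (p ^ (n + 1)) := lam_lt_totient_of_le (le_max_right _ _)
    have := (inv_lt_norm_sub_one_pow_iff hζ (lam H)).mpr hlt
    exact absurd hle (not_le.mpr this)

/-- `p ∣ G₁ − C(c)·G₂` in `Λ` ⟹ the coefficient congruence `[T^j]Ḡ₁ = c̄·[T^j]Ḡ₂` in `𝔽_p` for
every `j` (reduction by `PadicInt.toZMod`, the currency of the transfer sockets). [folklore] -/
theorem coeff_toZMod_eq_of_C_p_dvd_sub {G₁ G₂ : IwasawaAlgebra p} {c : ℤ_[p]}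
    (h : PowerSeries.C (p : ℤ_[p]) ∣ G₁ - PowerSeries.C c * G₂) (j : ℕ) :
    PowerSeries.coeff j (PowerSeries.map (PadicInt.toZMod (p := p)) G₁) =
      PadicInt.toZMod c * PowerSeries.coeff j (PowerSeries.map (PadicInt.toZMod (p := p)) G₂) := by
  obtain ⟨Q, hQ⟩ := h
  have hj : PowerSeries.coeff j G₁ = c * PowerSeries.coeff j G₂ + (p : ℤ_[p]) * PowerSeries.coeff j Q := by
    have := congrArg (PowerSeries.coeff j) hQ
    rw [map_sub, PowerSeries.coeff_C_mul, PowerSeries.coeff_C_mul] at this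
    rw [← this]; ring
  rw [PowerSeries.coeff_map, PowerSeries.coeff_map, hj, map_add, map_mul, map_mul, map_natCast,
    ZMod.natCast_self, zero_mul, add_zero]

/-- **Values ⟹ coefficients.** If `‖(G₁ − C(c)·G₂)(ζ − 1)‖ ≤ 1/p` at every primitive `p^{n+1}`-th
root of unity, `n ≥ n₀`, then `[T^j]Ḡ₁ = c̄·[T^j]Ḡ₂` in `𝔽_p` for every `j`.
[cite: Washington1997, §7.1–7.2, Thm. 7.3] -/
theorem forall_coeff_toZMod_eq_of_forall_norm_tsum_le {G₁ G₂ : IwasawaAlgebra p} {c : ℤ_[p]}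
    {n₀ : ℕ}
    (h : ∀ n : ℕ, n₀ ≤ n → ∀ ζ : ℂ_[p], IsPrimitiveRoot ζ (p ^ (n + 1)) →
      ‖∑' k, ((algebraMap ℚ_[p] ℂ_[p]).comp (algebraMap ℤ_[p] ℚ_[p]))
          (PowerSeries.coeff k (G₁ - PowerSeries.C c * G₂)) * (ζ - 1) ^ k‖ ≤ (p : ℝ)⁻¹) (j : ℕ) :
    PowerSeries.coeff j (PowerSeries.map (PadicInt.toZMod (p := p)) G₁) =
      PadicInt.toZMod c * PowerSeries.coeff j (PowerSeries.map (PadicInt.toZMod (p := p)) G₂) :=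
  coeff_toZMod_eq_of_C_p_dvd_sub (C_p_dvd_of_forall_norm_tsum_le h) j

/-- A `p`-adic unit reduces to a nonzero residue. [folklore] -/
theorem toZMod_ne_zero_of_isUnit {c : ℤ_[p]} (hc : IsUnit c) : PadicInt.toZMod c ≠ 0 :=
  (hc.map (PadicInt.toZMod (p := p))).ne_zero

end Algebra

/-! ## §2. X2 ← X2: the transfer socket fed by a congruence of values -/

section X2X2

variable {W : WeierstrassCurve ℚ} [W.IsElliptic] [W.IsGloballyMinimal]
  {N : ℕ} [NeZero N] {f : CuspForm (Gamma0 N) 2} {ϖ : ℚ} {L : PowerSeries ℚ_[p]}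
  {W' : WeierstrassCurve ℚ} [W'.IsElliptic] [W'.IsGloballyMinimal]
  {N' : ℕ} [NeZero N'] {f' : CuspForm (Gamma0 N') 2} {ϖ' : ℚ} {L' : PowerSeries ℚ_[p]}

/-- **X2 ← X2 from VALUES: `μ_an(W) = 0` and `λ_an(W) = n` at a multiplicative target from a
multiplicative twin's analytic invariants and ONE congruence of values at the `p`-power roots of
unity.** Data as in `EisensteinPrimesAnalyticLambdaCongruenceTransfer.X2.analyticMuLE_zero_and_
analyticLambdaEq_of_truncCongr` (`G, G′ ∈ Λ` the Néron-normalised `p`-adic `L`-functions of the target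
and the twin, multipliers `P, P′` of reduced orders `d, d′`, `P′` of unit content), except that the
truncated coefficient congruence is REPLACED by: a unit `c ∈ ℤ_p` and
`‖(G·P − C(c)·G′·P′)(ζ − 1)‖_p ≤ 1/p` for every primitive `p^{m+1}`-th root of unity `ζ ∈ ℂ_p`, all
`m ≥ n₀` — the output currency of MEMO-8 THEOREM A / Cor. A2 for case-(ii) twins (where `G·P`,
`G′·P′` are the ε-stabilised `p`-adic `L`-functions at the common level and the values are the
stabilised twisted special values). Conclusion: `X2.AnalyticMuLE W p 0 ∧ X2.AnalyticLambdaEq W p n`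
for the `n` with `n + d = n′ + d′` (Greenberg–Vatsal's (1.4)-type relative count).
[cite: GreenbergVatsal2000, §1 (9)–(10), Thm. (1.4)] [cite: Washington1997, §7.1–7.2, Thm. 7.3] -/
theorem X2.analyticMuLE_zero_and_analyticLambdaEq_of_valueCongr (hf : IsNewformOf W f)
    (hϖ : (ϖ : ℝ) * W.realPeriodRat = plusPeriod f)
    (hLs : W.HasSplitMultiplicativeReductionAtPrime p → IsSplitMultPAdicLFunctionOf f p L)
    (hLn : ¬ W.HasSplitMultiplicativeReductionAtPrime p → IsMultPAdicLFunctionOf f p (-1) L)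
    {G : IwasawaAlgebra p} (hG : iwasawaToPowerSeries p G = PowerSeries.C ((ϖ : ℚ) : ℚ_[p]) * L)
    (hf' : IsNewformOf W' f') (hϖ' : (ϖ' : ℝ) * W'.realPeriodRat = plusPeriod f')
    (hLs' : W'.HasSplitMultiplicativeReductionAtPrime p → IsSplitMultPAdicLFunctionOf f' p L')
    (hLn' : ¬ W'.HasSplitMultiplicativeReductionAtPrime p → IsMultPAdicLFunctionOf f' p (-1) L')
    {G' : IwasawaAlgebra p}
    (hG' : iwasawaToPowerSeries p G' = PowerSeries.C ((ϖ' : ℚ) : ℚ_[p]) * L')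
    (hμ' : X2.AnalyticMuLE W' p 0) {n' : ℕ} (hlam' : X2.AnalyticLambdaEq W' p n')
    {P P' : IwasawaAlgebra p} {d d' : ℕ}
    (hd : (PowerSeries.map (PadicInt.toZMod (p := p)) P).order = d) (hP' : HasUnitContent P')
    (hd' : (PowerSeries.map (PadicInt.toZMod (p := p)) P').order = d')
    {c : ℤ_[p]} (hc : IsUnit c) {n₀ : ℕ}
    (hval : ∀ m : ℕ, n₀ ≤ m → ∀ ζ : ℂ_[p], IsPrimitiveRoot ζ (p ^ (m + 1)) →
      ‖∑' k, ((algebraMap ℚ_[p] ℂ_[p]).comp (algebraMap ℤ_[p] ℚ_[p]))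
          (PowerSeries.coeff k (G * P - PowerSeries.C c * (G' * P'))) * (ζ - 1) ^ k‖ ≤ (p : ℝ)⁻¹)
    {n : ℕ} (hn : n + d = n' + d') :
    X2.AnalyticMuLE W p 0 ∧ X2.AnalyticLambdaEq W p n :=
  X2.analyticMuLE_zero_and_analyticLambdaEq_of_truncCongr hf hϖ hLs hLn hG hf' hϖ' hLs' hLn' hG'
    hμ' hlam' hd hP' hd' (toZMod_ne_zero_of_isUnit hc) (K := n' + d' + 1)
    (fun j _ ↦ forall_coeff_toZMod_eq_of_forall_norm_tsum_le hval j) (Nat.lt_succ_self _) hn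

end X2X2

end Summit.BirchSwinnertonDyer.BirchSwinnertonDyer.Theorems.EisensteinPrimesAnalyticLambdaValueCongruence
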